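import Summits.Ventures.PercRepro.S2MidFlatsEight

/-!
# PercRepro — S2: THE HEAVY RANK-`5` FLATS AT CORANK `10` — PAIRS AND TRIPLES (p7, gen 3; sub-claim S2)

Towards the cell `(21, 10)` of a «22» chain (proofs/P7-S2-LEVERS-G3.md, «The «22» pricing», (ii)): in a matroid with
`|E| = r(E) + 10`, lines of `≤ 3` points, planes of `≤ 6`, rank-`≤ 4` sets of `≤ 10`, call a rank-`5` flat HEAVY when it
has `≥ 12` points (nullity `≥ 7`; the mid closures of `spanMid M 5 10 9` are heavy). Two distinct heavy flats meet in a
rank-`4` flat of `≤ 10` points and span a rank-`6` flat (`two_heavy_flats_ten`: `ν(F ∩ F′) ≥ 7 + 7 − 10 = 4` forces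
rank `4`); for three, either the third lies in the closure of the union of the first two, or all three pairwise meet in
ONE rank-`4` flat (`heavy_triple_top_or_star`: the flat `cl(F₁ ∪ F₂) ∩ F₃` has rank `5` — then `F₃ ⊆ cl(F₁ ∪ F₂)` — or
rank `≤ 4`, and then it contains, hence equals, both `F₁ ∩ F₃` and `F₂ ∩ F₃`, which therefore equal `F₁ ∩ F₂`). The
counting of the two cases (the TOP: all heavy flats in one rank-`6` flat of `≤ 16` points; the STAR: all through one
rank-`4` flat, pairwise-disjoint remainders) is the next module. Axioms: standard.
-/

open scoped Matroid

namespace PercRepro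

namespace S2

open Set Finset

variable {α : Type} {M : Matroid α}

/-- Two nested flats of the same finite rank are equal. -/
theorem flat_eq_of_subset_of_eRk_eq [M.Finite] {A B : Set α} (hAE : A ⊆ M.E)
    (hAcl : M.closure A = A) (hBcl : M.closure B = B) (hAB : A ⊆ B) (hr : M.eRk B ≤ M.eRk A) : A = B := by
  have hAfin : A.Finite := M.ground_finite.subset hAE
  have h := (M.isRkFinite_of_finite hAfin).closure_eq_closure_of_subset_of_eRk_ge_eRk hAB hr
  rw [hAcl, hBcl] at h
  exact h

/-- The intersection of two flats is a flat. -/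
theorem closure_inter_eq_of_closure_eq {A B : Set α} (hAcl : M.closure A = A) (hBcl : M.closure B = B) :
    M.closure (A ∩ B) = A ∩ B := by
  apply Set.Subset.antisymm
  · exact Set.subset_inter ((M.closure_subset_closure Set.inter_subset_left).trans hAcl.subset)
      ((M.closure_subset_closure Set.inter_subset_right).trans hBcl.subset)
  · exact M.subset_closure _ (Set.inter_subset_left.trans (hAcl ▸ M.closure_subset_ground A))

/-- A flat `F′ ⊄ F` of rank `5` pushes the rank of `F ∪ F′` to `≥ 6` when `F` is a rank-`5` flat. -/
theorem six_le_eRk_union_of_flats [M.Finite] {F₁ F₂ : Set α} (h₁E : F₁ ⊆ M.E) (h₂E : F₂ ⊆ M.E)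
    (h₁r : M.eRk F₁ = 5) (h₂r : M.eRk F₂ = 5) (h₁cl : M.closure F₁ = F₁) (h₂cl : M.closure F₂ = F₂)
    (hne : F₁ ≠ F₂) : (6 : ℕ∞) ≤ M.eRk (F₁ ∪ F₂) := by
  by_contra hlt
  have h6 : M.eRk (F₁ ∪ F₂) < 6 := not_le.1 hlt
  have h₁fin : F₁.Finite := M.ground_finite.subset h₁E
  have h₂fin : F₂.Finite := M.ground_finite.subset h₂E
  have hUfin : (F₁ ∪ F₂).Finite := h₁fin.union h₂fin
  have hUne : M.eRk (F₁ ∪ F₂) ≠ ⊤ := ((M.eRk_le_encard _).trans_lt hUfin.encard_lt_top).ne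
  obtain ⟨ru, hru⟩ := ENat.ne_top_iff_exists.1 hUne
  have hle : M.eRk (F₁ ∪ F₂) ≤ 5 := by
    rw [← hru] at h6 ⊢
    have : ru < 6 := by exact_mod_cast h6
    exact_mod_cast (by omega : ru ≤ 5)
  have hc₁ : M.closure F₁ = M.closure (F₁ ∪ F₂) :=
    (M.isRkFinite_of_finite h₁fin).closure_eq_closure_of_subset_of_eRk_ge_eRk Set.subset_union_left
      (by rw [h₁r]; exact hle)
  have hc₂ : M.closure F₂ = M.closure (F₁ ∪ F₂) :=
    (M.isRkFinite_of_finite h₂fin).closure_eq_closure_of_subset_of_eRk_ge_eRk Set.subset_union_right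
      (by rw [h₂r]; exact hle)
  exact hne (by rw [← h₁cl, ← h₂cl, hc₁, hc₂])

/-- **Two distinct heavy rank-`5` flats at corank `10` meet in a rank-`4` flat of at most `10` points and span
rank `6`.** -/
theorem two_heavy_flats_ten [M.Finite]
    (hC1 : ∀ L ⊆ M.E, M.eRk L = 2 → L.ncard ≤ 3)
    (hflat' : ∀ X ⊆ M.E, M.eRk X ≤ ((5 - 1 : ℕ) : ℕ∞) → X.ncard ≤ 10)
    (hC2 : ∀ P ⊆ M.E, M.eRk P ≤ 3 → P.ncard ≤ 6) (hC0 : ∀ X ⊆ M.E, M.eRk X ≤ 1 → X.ncard ≤ 1)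
    (hd : M.E.encard = M.eRank + 10)
    {F₁ F₂ : Set α} (h₁E : F₁ ⊆ M.E) (h₂E : F₂ ⊆ M.E) (h₁r : M.eRk F₁ = 5) (h₂r : M.eRk F₂ = 5)
    (h₁c : 12 ≤ F₁.ncard) (h₂c : 12 ≤ F₂.ncard) (h₁cl : M.closure F₁ = F₁) (h₂cl : M.closure F₂ = F₂)
    (hne : F₁ ≠ F₂) :
    M.eRk (F₁ ∩ F₂) = 4 ∧ (F₁ ∩ F₂).ncard ≤ 10 ∧ M.eRk (F₁ ∪ F₂) = 6 := by
  have h₁fin : F₁.Finite := M.ground_finite.subset h₁E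
  have h₂fin : F₂.Finite := M.ground_finite.subset h₂E
  have hIE : F₁ ∩ F₂ ⊆ M.E := Set.inter_subset_left.trans h₁E
  have hIfin : (F₁ ∩ F₂).Finite := h₁fin.subset Set.inter_subset_left
  have hIne : M.eRk (F₁ ∩ F₂) ≠ ⊤ := ((M.eRk_le_encard _).trans_lt hIfin.encard_lt_top).ne
  obtain ⟨ri, hri⟩ := ENat.ne_top_iff_exists.1 hIne
  have hri5 : ri ≤ 5 := by
    have := M.eRk_mono (Set.inter_subset_left : F₁ ∩ F₂ ⊆ F₁)
    rw [← hri, h₁r] at this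
    exact_mod_cast this
  have hri4 : ri ≤ 4 := by
    by_contra hcon
    have hri5' : ri = 5 := by omega
    have hcl₁ : M.closure (F₁ ∩ F₂) = M.closure F₁ :=
      (M.isRkFinite_of_finite hIfin).closure_eq_closure_of_subset_of_eRk_ge_eRk Set.inter_subset_left
        (by rw [h₁r, ← hri, hri5']; rfl)
    have hcl₂ : M.closure (F₁ ∩ F₂) = M.closure F₂ :=
      (M.isRkFinite_of_finite hIfin).closure_eq_closure_of_subset_of_eRk_ge_eRk Set.inter_subset_right
        (by rw [h₂r, ← hri, hri5']; rfl)
    exact hne (by rw [← h₁cl, ← h₂cl, ← hcl₁, ← hcl₂])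
  have hIc10 : (F₁ ∩ F₂).ncard ≤ 10 := hflat' _ hIE (by rw [← hri]; exact_mod_cast hri4)
  have hIc6 : ri ≤ 3 → (F₁ ∩ F₂).ncard ≤ 6 := fun h =>
    hC2 _ hIE (by rw [← hri]; exact_mod_cast h)
  have hIc3 : ri = 2 → (F₁ ∩ F₂).ncard ≤ 3 := fun h =>
    hC1 _ hIE (by rw [← hri, h]; rfl)
  have hIc1 : ri ≤ 1 → (F₁ ∩ F₂).ncard ≤ 1 := fun h =>
    hC0 _ hIE (by rw [← hri]; exact_mod_cast h)
  -- submodularity, the nullity cap on the union, the rank of the union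
  have hsub := M.eRk_inter_add_eRk_union_le F₁ F₂
  rw [h₁r, h₂r, ← hri] at hsub
  have hUE : F₁ ∪ F₂ ⊆ M.E := Set.union_subset h₁E h₂E
  have hUfin : (F₁ ∪ F₂).Finite := h₁fin.union h₂fin
  have hUne : M.eRk (F₁ ∪ F₂) ≠ ⊤ := ((M.eRk_le_encard _).trans_lt hUfin.encard_lt_top).ne
  obtain ⟨ru, hru⟩ := ENat.ne_top_iff_exists.1 hUne
  rw [← hru] at hsub
  have hcap := Matroid.encard_le_eRk_add_of_encard_eq (M := M) hUE hd
  rw [← hru, ← hUfin.cast_ncard_eq] at hcap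
  have hcard := Set.ncard_union_add_ncard_inter F₁ F₂ h₁fin h₂fin
  have hru6 : 6 ≤ ru := by
    have := six_le_eRk_union_of_flats h₁E h₂E h₁r h₂r h₁cl h₂cl hne
    rw [← hru] at this
    exact_mod_cast this
  have e1 : ri + ru ≤ 5 + 5 := by exact_mod_cast hsub
  have e2 : (F₁ ∪ F₂).ncard ≤ ru + 10 := by exact_mod_cast hcap
  have hri4' : ri = 4 := by
    interval_cases ri
    · have := hIc1 (by norm_num); omega
    · have := hIc1 (by norm_num); omega
    · have := hIc3 rfl; omega
    · have := hIc6 (by norm_num); omega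
    · rfl
  refine ⟨by rw [← hri, hri4']; rfl, hIc10, ?_⟩
  have : ru = 6 := by omega
  rw [← hru, this]; rfl

/-- **Three distinct heavy flats at corank `10`: TOP or STAR.** Either the third lies in the closure of the union
of the first two, or the three pairwise intersections are one and the same rank-`4` flat. -/
theorem heavy_triple_top_or_star [M.Finite]
    (hC1 : ∀ L ⊆ M.E, M.eRk L = 2 → L.ncard ≤ 3)
    (hflat' : ∀ X ⊆ M.E, M.eRk X ≤ ((5 - 1 : ℕ) : ℕ∞) → X.ncard ≤ 10)
    (hC2 : ∀ P ⊆ M.E, M.eRk P ≤ 3 → P.ncard ≤ 6) (hC0 : ∀ X ⊆ M.E, M.eRk X ≤ 1 → X.ncard ≤ 1)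
    (hd : M.E.encard = M.eRank + 10)
    {F₁ F₂ F₃ : Set α} (h₁E : F₁ ⊆ M.E) (h₂E : F₂ ⊆ M.E) (h₃E : F₃ ⊆ M.E)
    (h₁r : M.eRk F₁ = 5) (h₂r : M.eRk F₂ = 5) (h₃r : M.eRk F₃ = 5)
    (h₁c : 12 ≤ F₁.ncard) (h₂c : 12 ≤ F₂.ncard) (h₃c : 12 ≤ F₃.ncard)
    (h₁cl : M.closure F₁ = F₁) (h₂cl : M.closure F₂ = F₂) (h₃cl : M.closure F₃ = F₃)
    (h₁₂ : F₁ ≠ F₂) (h₁₃ : F₁ ≠ F₃) (h₂₃ : F₂ ≠ F₃) :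
    F₃ ⊆ M.closure (F₁ ∪ F₂) ∨ (F₁ ∩ F₃ = F₁ ∩ F₂ ∧ F₂ ∩ F₃ = F₁ ∩ F₂) := by
  set W := M.closure (F₁ ∪ F₂) with hW
  have hWcl : M.closure W = W := M.closure_closure _
  have h₃fin : F₃.Finite := M.ground_finite.subset h₃E
  have hJcl : M.closure (W ∩ F₃) = W ∩ F₃ := closure_inter_eq_of_closure_eq hWcl h₃cl
  have hJE : W ∩ F₃ ⊆ M.E := Set.inter_subset_right.trans h₃E
  have hJfin : (W ∩ F₃).Finite := h₃fin.subset Set.inter_subset_right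
  have hJne : M.eRk (W ∩ F₃) ≠ ⊤ := ((M.eRk_le_encard _).trans_lt hJfin.encard_lt_top).ne
  obtain ⟨rj, hrj⟩ := ENat.ne_top_iff_exists.1 hJne
  have hrj5 : rj ≤ 5 := by
    have := M.eRk_mono (Set.inter_subset_right : W ∩ F₃ ⊆ F₃)
    rw [← hrj, h₃r] at this
    exact_mod_cast this
  rcases Nat.lt_or_ge rj 5 with hlt | hge
  · -- `W ∩ F₃` has rank `≤ 4`: it contains the rank-`4` flats `F₁ ∩ F₃` and `F₂ ∩ F₃`, hence equals both
    right
    obtain ⟨r₁₃, c₁₃, -⟩ := two_heavy_flats_ten hC1 hflat' hC2 hC0 hd h₁E h₃E h₁r h₃r h₁c h₃c h₁cl h₃cl h₁₃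
    obtain ⟨r₂₃, c₂₃, -⟩ := two_heavy_flats_ten hC1 hflat' hC2 hC0 hd h₂E h₃E h₂r h₃r h₂c h₃c h₂cl h₃cl h₂₃
    obtain ⟨r₁₂, c₁₂, -⟩ := two_heavy_flats_ten hC1 hflat' hC2 hC0 hd h₁E h₂E h₁r h₂r h₁c h₂c h₁cl h₂cl h₁₂
    have hrj4 : M.eRk (W ∩ F₃) ≤ 4 := by rw [← hrj]; exact_mod_cast (by omega : rj ≤ 4)
    have hW₁ : F₁ ⊆ W := Set.subset_union_left.trans (M.subset_closure _ (Set.union_subset h₁E h₂E))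
    have hW₂ : F₂ ⊆ W := Set.subset_union_right.trans (M.subset_closure _ (Set.union_subset h₁E h₂E))
    have hsub₁ : F₁ ∩ F₃ ⊆ W ∩ F₃ := Set.inter_subset_inter_left _ hW₁
    have hsub₂ : F₂ ∩ F₃ ⊆ W ∩ F₃ := Set.inter_subset_inter_left _ hW₂
    have hcl₁₃ : M.closure (F₁ ∩ F₃) = F₁ ∩ F₃ := closure_inter_eq_of_closure_eq h₁cl h₃cl
    have hcl₂₃ : M.closure (F₂ ∩ F₃) = F₂ ∩ F₃ := closure_inter_eq_of_closure_eq h₂cl h₃cl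
    have hcl₁₂ : M.closure (F₁ ∩ F₂) = F₁ ∩ F₂ := closure_inter_eq_of_closure_eq h₁cl h₂cl
    have e₁ : F₁ ∩ F₃ = W ∩ F₃ :=
      flat_eq_of_subset_of_eRk_eq (Set.inter_subset_left.trans h₁E) hcl₁₃ hJcl hsub₁ (by rw [r₁₃]; exact hrj4)
    have e₂ : F₂ ∩ F₃ = W ∩ F₃ :=
      flat_eq_of_subset_of_eRk_eq (Set.inter_subset_left.trans h₂E) hcl₂₃ hJcl hsub₂ (by rw [r₂₃]; exact hrj4)
    -- `K := W ∩ F₃` lies in `F₁ ∩ F₂`, a rank-`4` flat: equality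
    have hK₁₂ : W ∩ F₃ ⊆ F₁ ∩ F₂ := by
      intro x hx
      exact ⟨(e₁ ▸ hx : x ∈ F₁ ∩ F₃).1, (e₂ ▸ hx : x ∈ F₂ ∩ F₃).1⟩
    have e₃ : W ∩ F₃ = F₁ ∩ F₂ :=
      flat_eq_of_subset_of_eRk_eq hJE hJcl hcl₁₂ hK₁₂ (by rw [r₁₂, ← e₁, r₁₃])
    exact ⟨e₁.trans e₃, e₂.trans e₃⟩
  · -- rank `5`: `cl (W ∩ F₃) = cl F₃`, so `F₃ = W ∩ F₃ ⊆ W`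
    left
    have hrj5' : rj = 5 := by omega
    have hcl : M.closure (W ∩ F₃) = M.closure F₃ :=
      (M.isRkFinite_of_finite hJfin).closure_eq_closure_of_subset_of_eRk_ge_eRk Set.inter_subset_right
        (by rw [h₃r, ← hrj, hrj5']; rfl)
    rw [hJcl, h₃cl] at hcl
    rw [← hcl]
    exact Set.inter_subset_left

end S2

end PercRepro
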